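import Summits.NavierStokesRegularity.FluidComputer.SymmetryPlaneVorticityBudget
import Literature.Analysis.FluidPDE.ClassicalSolutionProofs
import HarnessLib

/-!
# Symmetry-plane flux law, III — the time derivative of the normal-vorticity content of a fixed
# mirror-plane rectangle along a classical Navier–Stokes / Euler flow

HONEST FRAMING (cell `ns-blowup`, lane W, seat `ns-blowup-wind`; human ruling D-0035). WHAT THIS
IS NOT: not a statement about Navier–Stokes blow-up in either direction and not about any
particular flow. It is the genuine `d/dt` form of the flux law of the companion file
`SymmetryPlaneVorticityBudget.lean` (`setIntegral_mirrorPlane_vorticity_eq`, which states the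
law for the integrated time derivative `∫_R ∂ₜωᵢ`): here the derivative is taken OUTSIDE the
integral, by differentiation under the integral sign within the time set (the tree's
`hasDerivWithinAt_integral_of_dominated_convex`, dominated convergence with the mean value
inequality), the domination coming from joint continuity of `∂ₜω` on the compact
`S × P([a, b])` (`IsSmoothSpaceTimeOn.timeDerivWithin`).

* `hasDerivWithinAt_setIntegral_curl_mirrorPlane` — for a classical solution
  `IsClassicalNSSolutionOn S ν f u p` on `ℝ³` (any real `ν`, Euler included; any force `f`) on a
  COMPACT CONVEX time set `S` (a slab `[T₀, T₁]`; maximal solutions on `[0, T*)` are restricted to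
  sub-slabs by `IsClassicalNSSolutionOn.mono` before use) with `S ⊆ closure (interior S)` and of
  unique differentiability, whose velocity slices are mirror-equivariant
  (`u s (reflC i x) = reflC i (u s x)`), the normal-vorticity content of a fixed plane rectangle
  `R = P([a₁,b₁]×[a₂,b₂])` of the mirror plane `{xᵢ = 0}` is differentiable within `S` at every
  `t ∈ S` with
  `d/dt ∫_R ωᵢ = ν ∫_R ∑ⱼ∂ⱼ∂ⱼωᵢ − ∮_{∂R} ωᵢ (u · n_out) + ∫_R (curl f)ᵢ`
  (edge term = the four signed edge integrals of the companion files). Apart from viscous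
  diffusion and the curl of the force, the flux through a fixed region of a symmetry plane changes
  only by transport across its edge by material points of the invariant plane.

All proved; 0 `sorry`; no definitions, no named facts. References: Majda–Bertozzi 2002 §1.4
(1.33) (vorticity equation); folklore (differentiation under the integral sign).
-/

noncomputable section

open MeasureTheory Set Function Filter Topology
open scoped BigOperators

namespace Summit.NavierStokesRegularity.FluidComputer.SymmetryPlaneFluxLaw

open Literature.Analysis.FluidPDE

section Rate

open scoped ContDiff

variable {S : Set ℝ} {ν : ℝ} {f u : ℝ → EuclideanSpace ℝ (Fin 3) → EuclideanSpace ℝ (Fin 3)}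
  {p : ℝ → EuclideanSpace ℝ (Fin 3) → ℝ}

/-- The vorticity components `(s, y) ↦ (curl u(s))(y)ᵢ` of a classical solution are jointly
smooth on `S × ℝ³` (`curl = curlCLM ∘ D`, the tree's `IsSmoothSpaceTimeOn.fderiv_slice`). -/
theorem isSmoothSpaceTimeOn_curl_apply (h : IsClassicalNSSolutionOn S ν f u p)
    (hS : UniqueDiffOn ℝ S) (i : Fin 3) :
    IsSmoothSpaceTimeOn S (fun s y => curl (u s) y i) :=
  ((h.smooth_velocity.fderiv_slice hS).clm_comp curlCLM).euclidean_comp i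

/-- **The flux law, `d/dt` form.** Along a classical Navier–Stokes / Euler solution on a compact
convex time set with mirror-equivariant velocity slices, the normal-vorticity content
`s ↦ ∫_R (curl u(s))ᵢ` of a fixed rectangle `R` of the mirror plane `{xᵢ = 0}` has, within `S` at
every `t ∈ S`, the derivative
`ν ∫_R ∑ⱼ∂ⱼ∂ⱼωᵢ − ([∫ u_{i+2}ωᵢ ds]_{t=a₂}^{t=b₂} + [∫ u_{i+1}ωᵢ dt]_{s=a₁}^{s=b₁}) + ∫_R (curl f)ᵢ`
— viscous diffusion, minus the outward edge transport by the in-plane velocity, plus the curl of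
the force. -/
theorem hasDerivWithinAt_setIntegral_curl_mirrorPlane
    {i : Fin 3} (h : IsClassicalNSSolutionOn S ν f u p) (hSc : IsCompact S) (hconv : Convex ℝ S)
    (hS : UniqueDiffOn ℝ S) (hcl : S ⊆ closure (interior S))
    (hsym : ∀ s ∈ S, ∀ x, u s (reflC i x) = reflC i (u s x))
    {t : ℝ} (ht : t ∈ S)
    {P : ℝ × ℝ → EuclideanSpace ℝ (Fin 3)}
    (hP : ∀ q, P q = q.1 • (stdVec (i + 1) : EuclideanSpace ℝ (Fin 3)) + q.2 • stdVec (i + 2))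
    {a b : ℝ × ℝ} (hab : a ≤ b) :
    HasDerivWithinAt (fun s => ∫ q in Icc a b, curl (u s) (P q) i)
      (ν * (∫ q in Icc a b, ∑ j, pderiv j (pderiv j fun y => curl (u t) y i) (P q)) -
        ((((∫ s in a.1..b.1, u t (P (s, b.2)) (i + 2) * curl (u t) (P (s, b.2)) i) -
            ∫ s in a.1..b.1, u t (P (s, a.2)) (i + 2) * curl (u t) (P (s, a.2)) i) +
          ∫ r in a.2..b.2, u t (P (b.1, r)) (i + 1) * curl (u t) (P (b.1, r)) i) -
        ∫ r in a.2..b.2, u t (P (a.1, r)) (i + 1) * curl (u t) (P (a.1, r)) i) +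
      ∫ q in Icc a b, curl (f t) (P q) i) S t := by
  -- the field, its time derivative, and their regularity (opaque names with defining equations)
  obtain ⟨W, hWdef⟩ : ∃ W : ℝ → EuclideanSpace ℝ (Fin 3) → ℝ, W = fun s y => curl (u s) y i :=
    ⟨_, rfl⟩
  have hW : IsSmoothSpaceTimeOn S W := hWdef ▸ isSmoothSpaceTimeOn_curl_apply h hS i
  obtain ⟨G, hGdef⟩ : ∃ G : ℝ → EuclideanSpace ℝ (Fin 3) → ℝ,
      G = Literature.Analysis.FluidPDE.timeDerivWithin S W := ⟨_, rfl⟩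
  have hG : IsSmoothSpaceTimeOn S G := hGdef ▸ hW.timeDerivWithin hS
  have hPc : Continuous P := by
    have : P = fun q => q.1 • (stdVec (i + 1) : EuclideanSpace ℝ (Fin 3)) + q.2 • stdVec (i + 2) :=
      funext hP
    rw [this]; fun_prop
  -- the clamp onto the rectangle (to state a global domination)
  obtain ⟨ρ, hρdef⟩ : ∃ ρ : ℝ × ℝ → ℝ × ℝ,
      ρ = fun q => (max a.1 (min b.1 q.1), max a.2 (min b.2 q.2)) := ⟨_, rfl⟩
  have hρc : Continuous ρ := by
    rw [hρdef]
    refine Continuous.prodMk ?_ ?_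
    · exact continuous_const.max (continuous_const.min continuous_fst)
    · exact continuous_const.max (continuous_const.min continuous_snd)
  have hρmem : ∀ q, ρ q ∈ Icc a b := fun q => by
    rw [hρdef]
    exact ⟨⟨le_max_left _ _, le_max_left _ _⟩,
      ⟨max_le hab.1 (min_le_left _ _), max_le hab.2 (min_le_left _ _)⟩⟩
  have hρid : ∀ q ∈ Icc a b, ρ q = q := by
    rintro ⟨q₁, q₂⟩ ⟨⟨h1, h2⟩, ⟨h3, h4⟩⟩
    rw [hρdef]
    simp only [Prod.mk.injEq]
    exact ⟨by rw [min_eq_right h3, max_eq_right h1], by rw [min_eq_right h4, max_eq_right h2]⟩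
  -- a uniform bound for the time derivative on the compact `S × [a, b]`
  have hGc : ContinuousOn (fun z : ℝ × (ℝ × ℝ) => G z.1 (P z.2)) (S ×ˢ univ) := by
    have h1 : ContinuousOn (uncurry G) (S ×ˢ univ) := hG.continuousOn
    have h2 : Continuous fun z : ℝ × (ℝ × ℝ) => ((z.1, P z.2) : ℝ × EuclideanSpace ℝ (Fin 3)) :=
      continuous_fst.prodMk (hPc.comp continuous_snd)
    exact h1.comp h2.continuousOn fun z hz => ⟨hz.1, mem_univ _⟩
  obtain ⟨M, hM⟩ : ∃ M, ∀ z ∈ S ×ˢ Icc a b, ‖G z.1 (P z.2)‖ ≤ M :=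
    (hSc.prod isCompact_Icc).exists_bound_of_continuousOn
      (hGc.mono (prod_mono Subset.rfl (subset_univ _)))
  -- differentiation under the integral sign within the convex time set
  obtain ⟨F, hFdef⟩ : ∃ F : ℝ → ℝ × ℝ → ℝ, F = fun s q => W s (P (ρ q)) := ⟨_, rfl⟩
  obtain ⟨F', hF'def⟩ : ∃ F' : ℝ → ℝ × ℝ → ℝ, F' = fun s q => G s (P (ρ q)) := ⟨_, rfl⟩
  have hFc : ∀ s ∈ S, Continuous (F s) := fun s hs => by
    rw [hFdef]
    exact ((hW.contDiff_slice hs).continuous.comp hPc).comp hρc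
  have h1 : ∀ s ∈ S, AEStronglyMeasurable (F s) (volume.restrict (Icc a b)) :=
    fun s hs => (hFc s hs).aestronglyMeasurable
  have h2 : Integrable (F t) (volume.restrict (Icc a b)) :=
    (hFc t ht).continuousOn.integrableOn_compact isCompact_Icc
  have h3 : ∀ s ∈ S, ∀ q, ‖F' s q‖ ≤ (fun _ : ℝ × ℝ => M) q := fun s hs q => by
    rw [hF'def]
    exact hM (s, ρ q) ⟨hs, hρmem q⟩
  have h4 : Integrable (fun _ : ℝ × ℝ => M) (volume.restrict (Icc a b)) :=
    continuous_const.continuousOn.integrableOn_compact isCompact_Icc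
  have h5 : ∀ s ∈ S, ∀ q, HasDerivWithinAt (fun s' => F s' q) (F' s q) S s := fun s hs q => by
    rw [hFdef, hF'def, hGdef]
    exact hW.hasDerivWithinAt_timeDerivWithin hS hs (P (ρ q))
  have hkey : HasDerivWithinAt (fun s => ∫ q in Icc a b, F s q) (∫ q in Icc a b, F' t q) S t :=
    hasDerivWithinAt_integral_of_dominated_convex hconv ht h1 h2 h3 h4 h5
  -- undo the clamp inside the rectangle and insert the integrated law
  have hFeq : (fun s => ∫ q in Icc a b, F s q) = fun s => ∫ q in Icc a b, curl (u s) (P q) i := by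
    funext s
    exact setIntegral_congr_fun measurableSet_Icc fun q hq => by
      simp only [hFdef, hWdef, hρid q hq]
  have hF'eq : ∫ q in Icc a b, F' t q =
      ∫ q in Icc a b, Literature.Analysis.FluidPDE.timeDerivWithin S
        (fun s y => curl (u s) y i) t (P q) :=
    setIntegral_congr_fun measurableSet_Icc fun q hq => by
      simp only [hF'def, hGdef, hWdef, hρid q hq]
  rw [hFeq, hF'eq, setIntegral_mirrorPlane_vorticity_eq h hS hcl hsym ht hP hab] at hkey
  exact hkey

end Rate

end Summit.NavierStokesRegularity.FluidComputer.SymmetryPlaneFluxLaw
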